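import Summits.CriticalPhenomena.PercolationContinuityZ3.Theorems.PercNearOneGluingNoHeavyQuantTorqueRoutes
import HarnessLib

/-!
# QUANT lane R8, T-DEC: LIGHT-MEAN FORESTS (`fmean ≤ 2`) ARE SDEC AT EVERY TOP-AFFORDABLE FLOOR — any width, any sub-forests, no oracle
# (arm-1 gen 54, architect; the k-general corollary of the empty torque transport)

builds on p205010 (kernel theorem, internal audit signed; external expert review pending)

Support file (`--supports stmt-CriticalPhenomena-4575`), QUANT lane seat prim-quant-arm-1 (gen 54, architect); memo
`run/shared/lean/prim/quant/prim-quant-arm-1-g54/ARCH-G54.md`.  Theorems only, standard axioms, no sorries.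

WHY.  Under every outer gate `a ∈ (0,1]` the gated forest law has mean `T = a·fmean L ≤ 2`, so NO positive atom is low (`2l < T` forces `l = 0`): the
torque-cost criterion with the EMPTY transport (`decAt_all_of_noPosLow`, `…QuantTorqueRoutes`) gives DEC at every layer — the zero atom rides its levers
on the torque `Σ_{h>T}(h−T)μ_h = T·μ₀ + Σ_{1≤l<T}(T−l)μ_l`.  The only floor condition is top-affordability `x·ftop L ≤ fmean L`, automatic for tree-OK
siblings.  This complements `sdec_flaw_of_halfTop` (`2x·ftop ≤ fmean`, any mean; `…QuantHalfTop`): for light-mean forests the admissible floor range doubles.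

* **`sdec_flaw_of_fmean_le_two`** — law-OK siblings, `0 < fmean L ≤ 2`, `0 < x < 1`, `x·ftop L ≤ fmean L` ⟹ `SDEC x (ftop L) (flaw L)`;
* **`sdec_flaw_of_fmean_le_two_treeOK`** — tree-OK siblings (non-empty list) with `fmean L ≤ 2` ⟹ `SDEC x (ftop L) (flaw L)`.

HONEST STATUS.  A small unconditional family; `SiblingStep`, `GateStepN`, `FarTreeRow` OPEN; RATE class (log\*) / honest sentence of
`run/shared/lean/prim/quant/README.md` unchanged.  [this work].  Nothing here is cited as a published result.  The gluing rows served
[cite: KozmaNitzan2024, Conjecture 3 (p. 15)]; product measure [cite: Grimmett1999, §1.3 p. 10].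
-/

noncomputable section

open scoped BigOperators

namespace Summit.CriticalPhenomena.PercolationContinuityZ3.Theorems
namespace Quant
namespace LawDec

open Finset

/-- **LIGHT-MEAN FORESTS ARE SDEC AT EVERY TOP-AFFORDABLE FLOOR.**  Law-OK siblings with `0 < fmean L ≤ 2`, a floor `0 < x < 1` with
`x·ftop L ≤ fmean L`: `SDEC x (ftop L) (flaw L)` — for every outer gate the gated mean is `≤ 2`, no positive atom is low, and the zero atom rides the
torque (`decAt_all_of_noPosLow`). [this work] -/
theorem sdec_flaw_of_fmean_le_two {x : ℝ} (hx0 : 0 < x) (hx1 : x < 1) (L : List Sib) (hL : ∀ s ∈ L, s.LawOK)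
    (hm0 : 0 < fmean L) (hm2 : fmean L ≤ 2) (hta : x * (ftop L : ℝ) ≤ fmean L) : SDEC x (ftop L) (flaw L) := by
  intro a ha0 ha1 j hj
  obtain ⟨f0, fM, f1, fmn⟩ := flaw_facts L hL
  obtain ⟨g0, gM, g1⟩ := gate_laws (ftop L) (flaw L) a ha0.le ha1 f0 fM f1
  have gmn : ∑ h ∈ Finset.range (ftop L + 1), (h : ℝ) * gate (flaw L) a h = a * fmean L := by rw [sum_mul_gate, fmn]
  have hy0 : 0 < a * x := mul_pos ha0 hx0
  have hy1 : a * x < 1 := lt_of_le_of_lt (mul_le_of_le_one_left hx0.le ha1) hx1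
  have hT0 : 0 < a * fmean L := mul_pos ha0 hm0
  have hT2 : a * fmean L ≤ 2 := le_trans (mul_le_of_le_one_left hm0.le ha1) hm2
  have hta' : a * x * (ftop L : ℝ) ≤ a * fmean L := by
    rw [mul_assoc]; exact mul_le_mul_of_nonneg_left hta ha0.le
  exact decAt_all_of_noPosLow (a * x) (ftop L) _ (a * fmean L) hy0 hy1 g0 gM g1 gmn hT0 hT2 hta' j hj

/-- **TREE-OK LIGHT-MEAN FORESTS ARE SDEC AT THEIR FLOOR** (any width, any sub-forests, no oracle): tree-OK siblings at the floor `0 < x < 1` (a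
non-empty list) with `fmean L ≤ 2` ⟹ `SDEC x (ftop L) (flaw L)`; top-affordability comes from the tree-built certificate of the forest law. [this work] -/
theorem sdec_flaw_of_fmean_le_two_treeOK {x : ℝ} (hx0 : 0 < x) (hx1 : x < 1) (L : List Sib) (hL : ∀ s ∈ L, s.TreeOK x) (hne : L ≠ [])
    (hm2 : fmean L ≤ 2) : SDEC x (ftop L) (flaw L) := by
  have hL' : ∀ s ∈ L, s.LawOK := fun s hs => (hL s hs).lawOK
  obtain ⟨_, _, _, fmn⟩ := flaw_facts L hL'
  obtain ⟨_, _, _, _, _, hta⟩ := (compForestN_of_list hx0 hx1 L hL).treeBuiltN.lawFacts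
  rw [fmn] at hta
  exact sdec_flaw_of_fmean_le_two hx0 hx1 L hL' ((fmean_pos L hL).2 hne) hm2 hta

end LawDec
end Quant
end Summit.CriticalPhenomena.PercolationContinuityZ3.Theorems
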